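import Literature.AnabelianGeometry.EtaleTheta.BiKummerGaloisSurjLaws
import Literature.AnabelianGeometry.EtaleTheta.Discharge.Sec4GaloisSurjNatural
import Literature.AnabelianGeometry.EtaleTheta.Discharge.Sec4GaloisSurjNaturalModel
import HarnessLib

/-!
# [EtTh] Def. 4.1 (ii): the named laws `GaloisSurjNatural` / `IsOpenKerGaloisSurj` HOLD at the canonical
# model setting, and plug into the §4 consumers by name (PROVED; no definitions)

Proof-only companion of `BiKummerGaloisSurjLaws.lean` (abc-iut-L2-t3, owner of `BiKummerSetting`).
S. Mochizuki, *The étale theta function …*, Publ. RIMS **45** (2009) [EtTh], §4, Def. 4.1 (ii), PDF p.87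
[cite: MochizukiEtTh2009, Def 4.1 (ii) p.87]: "a natural surjective outer homomorphism `Π^tp_X ↠ Aut_D(A^bs)`".

* `mkOfModelCanonical_galoisSurjNatural`, `mkOfModelCanonical_isOpenKerGaloisSurj` — the two named laws
  for abc-iut-L2-t9's canonical model setting over the genuine temperoid `B^temp(Π^tp_X)` fed with the
  temperoid's Galois data, ONE-LINE instances of abc-iut-w5-d013's `galoisSurjOf_natural` /
  `isOpen_ker_galoisSurjOf` (`Sec4GaloisSurjNaturalModel.lean`);
* `isOpen_Hodot_of_isOpenKerGaloisSurj` — the Thm. 4.4 standing clause "`H_⊙ ⊆ Π^tp_X` open"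
  (`Thm44Hyp.isOpen_Hodot`) from `IsOpenKerGaloisSurj`;
* `conjAut_eq_of_galoisSurjNatural` — d013's consequence `conjAut_eq_of_natural` with the binder `hS`
  supplied BY NAME (`S.GaloisSurjNatural` is that binder, definitionally).
HONEST FRAMING: refereed pre-IUT material; nothing here bears on [IUTchIII] Cor. 3.12; here PROVED.
-/

noncomputable section

namespace Literature.AnabelianGeometry.EtaleTheta

open CategoryTheory Opposite Literature.AlgebraicGeometry.Frobenioids
  Literature.AnabelianGeometry.SemiGraphs Literature.AnabelianGeometry.SemiGraphs.GaloisObjects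

namespace BiKummerSetting

universe u₀ v₀ u v w

section Abstract

variable {K : Type u₀} [Field K] {X : SemiGraphs.TemperedArithmeticGroup.{u₀} K} {D₀ : Type u₀}
  [Category.{v₀} D₀] {V : FrdIMonoidStub.{w}} {T : RealifiedDivisorMonoids (D₀ := D₀) V} {D : Type u}
  [Category.{v} D] {VD : FrdICatStub.{u, v, w} D} (S : BiKummerSetting X T D VD)

/-- Under `IsOpenKerGaloisSurj`, "`H_⊙ ⊆ Π^tp_X` … open" (Thm. 4.4 standing clause, field
`Thm44Hyp.isOpen_Hodot`) is automatic: `H_⊙ = Ker(Π^tp_X ↠ Aut_D(A_⊙^bs))`.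
[cite: MochizukiEtTh2009, Thm 4.4 p.93] -/
theorem isOpen_Hodot_of_isOpenKerGaloisSurj (h : S.IsOpenKerGaloisSurj) : IsOpen (S.Hodot : Set X.Pi) :=
  h _ S.isGalois_Aodot

/-- d013's `conjAut_eq_of_natural` with the naturality binder supplied BY NAME: under `GaloisSurjNatural`,
transporting `galoisSurj_B` along an isomorphism `e : B ≅ A` of Galois objects gives `galoisSurj_A` up to an
inner automorphism of `Π^tp_X`. [cite: MochizukiEtTh2009, Def 4.1 (ii) p.87] -/
theorem conjAut_eq_of_galoisSurjNatural (hS : S.GaloisSurjNatural) {A B : D} (hA : S.IsGaloisObj A)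
    (hB : S.IsGaloisObj B) (e : B ≅ A) :
    ∃ c : X.Pi, ∀ g : X.Pi, e.conjAut (S.galoisSurj B hB g) = S.galoisSurj A hA (c * g * c⁻¹) :=
  S.conjAut_eq_of_natural hS hA hB e

end Abstract

/-! ### The canonical model setting over the genuine temperoid -/

section Canonical

variable {K : Type u₀} [Field K] (X : SemiGraphs.TemperedArithmeticGroup.{u₀} K) {D₀ : Type u₀}
  [Category.{v₀} D₀] {V : FrdIMonoidStub.{w}} {T : RealifiedDivisorMonoids (D₀ := D₀) V}
  {VD : FrdICatStub.{u₀ + 1, u₀, w} (BTemp X.Pi)}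
  (tf : TemperedFrobenioid T (BTemp X.Pi) VD) (hZ : tf.monoidType = MonoidType.Z)
  (hP : ∀ A : (BTemp X.Pi)ᵒᵖ, IsPerfect (tf.Φ.carrier A))
  (NH : Subgroup (Field.absoluteGaloisGroup K) → tf.category → ℕ+ → Prop) (A₀ : tf.category)
  (hA₀ : PreFrobenioid.IsFrobeniusTrivial tf.toElem A₀) (hA₀' : SemiGraphs.IsGaloisObj A₀.base)

/-- **`GaloisSurjNatural` HOLDS for the canonical model setting** fed with the temperoid's Galois data
`(IsGaloisObj, galoisSurjOf)` — abc-iut-w5-d013's `galoisSurjOf_natural`.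
[cite: MochizukiEtTh2009, Def 4.1 (ii) p.87] -/
theorem mkOfModelCanonical_galoisSurjNatural :
    (BiKummerSetting.mkOfModelCanonical X tf hZ hP SemiGraphs.IsGaloisObj
      (fun A h => galoisSurjOf X.isTempered A h) (fun A h => galoisSurjOf_surjective X.isTempered A h)
      NH A₀ hA₀ hA₀').GaloisSurjNatural :=
  mkOfModelCanonical_galoisSurj_natural X tf hZ hP NH A₀ hA₀ hA₀'

/-- **`IsOpenKerGaloisSurj` HOLDS for the canonical model setting** — abc-iut-w5-d013's
`isOpen_ker_galoisSurjOf`. [cite: MochizukiEtTh2009, Def 4.1 (ii) p.87] -/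
theorem mkOfModelCanonical_isOpenKerGaloisSurj :
    (BiKummerSetting.mkOfModelCanonical X tf hZ hP SemiGraphs.IsGaloisObj
      (fun A h => galoisSurjOf X.isTempered A h) (fun A h => galoisSurjOf_surjective X.isTempered A h)
      NH A₀ hA₀ hA₀').IsOpenKerGaloisSurj :=
  fun A hA => mkOfModelCanonical_isOpen_ker_galoisSurj X tf hZ hP NH A₀ hA₀ hA₀' A hA

/-- Hence "`H_⊙ ⊆ Π^tp_X` open" for the canonical model setting over the genuine temperoid.
[cite: MochizukiEtTh2009, Thm 4.4 p.93] -/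
theorem mkOfModelCanonical_isOpen_Hodot :
    IsOpen ((BiKummerSetting.mkOfModelCanonical X tf hZ hP SemiGraphs.IsGaloisObj
      (fun A h => galoisSurjOf X.isTempered A h) (fun A h => galoisSurjOf_surjective X.isTempered A h)
      NH A₀ hA₀ hA₀').Hodot : Set X.Pi) :=
  isOpen_Hodot_of_isOpenKerGaloisSurj _ (mkOfModelCanonical_isOpenKerGaloisSurj X tf hZ hP NH A₀ hA₀ hA₀')

end Canonical

end BiKummerSetting

end Literature.AnabelianGeometry.EtaleTheta

end
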